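import Summits.BirchSwinnertonDyer.Rank1Residual.Iwasawa.LocalTowerKernelAdditive
import Summits.BirchSwinnertonDyer.Rank1Residual.GaloisImage.TorsionIsoImageObstruction
import Summits.BirchSwinnertonDyer.Rank1Residual.Partition.Rows
import Literature.NumberTheory.EllipticCurves.Rank1Residual.Predicates
import Literature.NumberTheory.EllipticCurves.Rank1Residual.X11
import Literature.NumberTheory.EllipticCurves.BSDSelmerPConverseRamifiedProofs
import Literature.NumberTheory.EllipticCurves.MultiplicativeInertiaLineProofs
import Literature.NumberTheory.EllipticCurves.MultiplicativeUnramifiedTorsionProofs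
import Literature.NumberTheory.EllipticCurves.SelmerFiniteProofs
import Literature.NumberTheory.EllipticCurves.LocalTorsionMultiplicativeProofs
import Literature.NumberTheory.EllipticCurves.BSDConductorProofs
import HarnessLib

/-!
# Skinner's auxiliary-prime hypothesis (ram) is an invariant of the mod-`p` Galois module `E[p]`
# (`p ≥ 5`): no level-raised / congruent partner of an X11a pair acquires it
# (cell `bsd-print-x11a`, D-0131 (2) PRINT TIER, leaf `ClassX11a`; prover seat p2 —
# «manufacture the auxiliary prime by Ribet / Diamond–Taylor level-raising … transport back along the
# congruence»; THEOREMS ONLY, 0 named facts, nothing booked)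

WHY. The leaf `ClassX11a W p` (`r_an = 0`, `p` odd, `p ‖ N`, `E[p]` irreducible, `¬ Ram W p`) is the
complement, inside Skinner's row C1 (Pacific J. Math. 283 (2016) Thm. C), of hypothesis (ii) "there is
a prime `q ≠ p` with `q ‖ N` at which `ρ̄_{E,p}` is RAMIFIED" — the tree's `Ram W p :=
∃ ℓ ≠ p, ℓ ‖ N, p ∤ v_ℓ(Δ_min)` (Tate curve). Seat p2's strategy sentence asks to MANUFACTURE such a
prime on a `p`-congruent newform (Ribet / Diamond–Taylor level-raising at an admissible `q`) and to
transport `BSD_p` back along the congruence (Greenberg–Vatsal / Emerton–Pollack–Weston). This file is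
the kernel form of why the first half is void for `p ≥ 5`: hypothesis (ii) is a property of the
`Γ_ℚ`-module `E[p]` ALONE — at a prime `ℓ ≠ p`, "`ℓ ‖ N` and `ρ̄_{E,p}` ramified at `ℓ`" is
equivalent to "the inertia group at `ℓ` acts NON-trivially on `E[p]` AND fixes a non-zero vector",
and for `p ≥ 5` the second condition characterises multiplicative reduction among bad primes
(additive `ℓ ∤ p` ⇒ `E[p]^{I_ℓ} = 0` by Kodaira–Néron, `c_ℓ ≤ 4 < p`; good ⇒ unramified,
Néron–Ogg–Shafarevich). Hence `Ram` is transported along EVERY `Γ_ℚ`-equivariant isomorphism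
`E[p] ≃ E'[p]` (`ram_iff_of_torsionIso`): a level-raised form (whose `ρ̄` is unramified at the new
prime), a Hida-family member, a CM or level-lowered partner of an X11a curve never meets Skinner 2016
Thm. C (ii) / Skinner–Urban 2014 Thm. 3.6.4 (iii) / Skinner–Zhang 2014 ♠(3) / BSTW 2024 (ram) when
read back on an elliptic curve over `ℚ` (`not_ram_of_torsionIso`, `not_rowC1_of_torsionIso_of_classX11a`).
The only loophole is `p = 3` (additive `ℓ` of Kodaira type IV / IV*, where `E[3]^{I_ℓ}` is a line):
the hypothesis `5 ≤ p` below is sharp.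

All local inputs are PROVED tree theorems (no named fact): `exists_inertia_smul_ne_of_hasMultiplicative
ReductionAtPrime` (Tate curve, bsd.S20), `exists_tateBasis_localPoints_of_hasMultiplicativeReductionAt`,
`smul_eq_of_mem_inertia_of_hasMultiplicativeReductionAt_of_dvd` (Serre 1972 n° 1.12), `smul_localPoints_eq_
of_mem_inertia_holds` (*AEC* VII.4.1), `Iwasawa.localPoints_eq_zero_of_absInertia_fixed_of_hasAdditiveReductionAt`.
Vocabulary: `absInertia ℚ_v ≤ Γ_{ℚ_v}` acts on `E[p] = geomTorsion W p` through `resGal ℚ_v : Γ_{ℚ_v} → Γ_ℚ`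
(chosen embedding `ℚ̄ → \bar{ℚ_v}`, `Sha.lean`), compatibly with `pointsMap` (`pointsMap_smul`).

* §1 transport of "ramified at `v`" / "non-zero inertia-fixed vector at `v`" along `e : E[p] ≃ E'[p]`;
* §2 the five local facts in this vocabulary (mult & `p ∤ v(Δ)` ⇒ ramified; mult ⇒ fixed vector;
  additive & `p ≥ 5` ⇒ no fixed vector; good ⇒ unramified; mult & `p ∣ v(Δ)` ⇒ unramified);
* §3 **`ram_of_torsionIso`, `ram_iff_of_torsionIso`** (`p ≥ 5`), `not_ram_of_torsionIso`, and the
  X11a reading `not_rowC1_of_torsionIso_of_classX11a` (no congruent partner of an X11a pair is in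
  Skinner's row C1 at `p`).

Beyond-print theorem: NO (folklore local theory: Serre 1972 §1.11–1.12, Silverman *AEC* VII.4.1/
VII.6.1); the kernel statement serves the residual crux (item 19064 `X11aLowerHalf`): p2's road reduces
to the congruence transport of record (`X11a/ChainAnyLevel.lean`), whose residue is Greenberg's `μ = 0`.
References: [Skinner2016PacificMC] Thm. C (ii), §2.5; [SkinnerUrban2014] Thm. 3.6.4 (iii); [SkinnerZhang2014]
♠(3), Thm. 1.1 (e); [BurungaleSkinnerTianWan2024] Thm. 1.9 (ram); [SerreInventiones1972] §1.11–1.12;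
[SilvermanAEC2009] VII.4.1, VII.6.1; [GreenbergLNM1716] p. 88, Prop. 3.8; cell STATUS 2026-08-27 p2 FINDING.
-/

set_option autoImplicit false
set_option linter.dupNamespace false -- the directory name repeats the summit name (sibling precedent)

noncomputable section

open scoped Classical NNReal

namespace Summit.BirchSwinnertonDyer.BirchSwinnertonDyer.Theorems.RamCongruence

open NumberField IsDedekindDomain Field IsDedekindDomain.HeightOneSpectrum Rat.HeightOneSpectrum
open WeierstrassCurve Literature.NumberTheory.EllipticCurves
  Literature.NumberTheory.EllipticCurves.Rank1Residual
  Literature.NumberTheory.GaloisRepresentations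
  Literature.NumberTheory.GaloisRepresentations.IsNonarchimedeanLocalField
  Summit.BirchSwinnertonDyer.Rank1Residual

variable {W W' : WeierstrassCurve ℚ} {p : ℕ} [hp : Fact p.Prime] (v : HeightOneSpectrum (𝓞 ℚ))

/-! ## §1 Transport along a `Γ_ℚ`-equivariant isomorphism `E[p] ≃ E'[p]` -/

omit hp in
/-- "`E[p]` is ramified at `v`" (some element of the inertia group `I_v ≤ Γ_{ℚ_v}`, acting through
`resGal`, moves a `p`-torsion point) passes along a `Γ_ℚ`-equivariant isomorphism `E[p] ≃ E'[p]`.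
[folklore] -/
theorem exists_smul_ne_of_torsionIso
    (e : geomTorsion W (p : ℤ) ≃+ geomTorsion W' (p : ℤ))
    (he : ∀ (σ : absoluteGaloisGroup ℚ) (P : geomTorsion W (p : ℤ)), e (σ • P) = σ • e P)
    (h : ∃ τ ∈ absInertia (v.adicCompletion ℚ), ∃ P : geomTorsion W (p : ℤ),
      resGal (K := ℚ) (v.adicCompletion ℚ) τ • P ≠ P) :
    ∃ τ ∈ absInertia (v.adicCompletion ℚ), ∃ P : geomTorsion W' (p : ℤ),
      resGal (K := ℚ) (v.adicCompletion ℚ) τ • P ≠ P := by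
  obtain ⟨τ, hτ, P, hP⟩ := h
  refine ⟨τ, hτ, e P, fun h' ↦ hP (e.injective ?_)⟩
  rw [he, h']

omit hp in
/-- "`E[p]` has a non-zero `I_v`-fixed vector" passes along a `Γ_ℚ`-equivariant isomorphism
`E[p] ≃ E'[p]`. [folklore] -/
theorem exists_fixed_ne_zero_of_torsionIso
    (e : geomTorsion W (p : ℤ) ≃+ geomTorsion W' (p : ℤ))
    (he : ∀ (σ : absoluteGaloisGroup ℚ) (P : geomTorsion W (p : ℤ)), e (σ • P) = σ • e P)
    (h : ∃ P : geomTorsion W (p : ℤ), P ≠ 0 ∧ ∀ τ ∈ absInertia (v.adicCompletion ℚ),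
      resGal (K := ℚ) (v.adicCompletion ℚ) τ • P = P) :
    ∃ P : geomTorsion W' (p : ℤ), P ≠ 0 ∧ ∀ τ ∈ absInertia (v.adicCompletion ℚ),
      resGal (K := ℚ) (v.adicCompletion ℚ) τ • P = P := by
  obtain ⟨P, hP0, hP⟩ := h
  refine ⟨e P, fun h0 ↦ hP0 (e.injective (by rw [h0, map_zero])), fun τ hτ ↦ ?_⟩
  rw [← he, hP τ hτ]

/-! ## §2 The local facts, read on `E[p] = E(ℚ̄)[p]` through `resGal` -/

section Local

variable (W)

/-- `v ∤ p` for the place `v` of `𝓞 ℚ` over a prime `ℓ ≠ p`. [folklore] -/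
theorem natCast_not_mem_of_ne {ℓ : ℕ} (hℓ : ℓ.Prime) (hv : primesEquiv v = ⟨ℓ, hℓ⟩) (hℓp : ℓ ≠ p) :
    (p : 𝓞 ℚ) ∉ v.asIdeal := by
  intro hmem
  have h := (natCast_mem_asIdeal_iff_eq_primesEquiv_symm v hp.out).mp hmem
  apply hℓp
  have h2 : primesEquiv v = ⟨p, hp.out⟩ := by rw [h, Equiv.apply_symm_apply]
  rw [hv] at h2
  exact congrArg Subtype.val h2

/-- **Multiplicative reduction at `v ∤ p` with `p ∤ ord_v(Δ_min)` ⟹ `E[p]` is ramified at `v`**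
(Tate curve; tree `exists_inertia_smul_ne_of_hasMultiplicativeReductionAtPrime`, read on `E(ℚ̄)[p]`
through `pointsMap`). [cite: SilvermanATAEC1994, V.4–V.5 and Exercise 5.13(b)]
[cite: SerreInventiones1972, §1.12] -/
theorem exists_smul_ne_of_mult_of_not_dvd [W.IsElliptic] [W.IsGloballyMinimal]
    (hpv : (p : 𝓞 ℚ) ∉ v.asIdeal) (hmult : W.HasMultiplicativeReductionAt v)
    (hnd : ¬ p ∣ W.ordMinimalDiscriminant v) :
    ∃ τ ∈ absInertia (v.adicCompletion ℚ), ∃ P : geomTorsion W (p : ℤ),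
      resGal (K := ℚ) (v.adicCompletion ℚ) τ • P ≠ P := by
  obtain ⟨w, hw⟩ := v.exists_spectralValuation
  obtain ⟨𝔐, h𝔐⟩ := v.localPrimesAbove_nonempty
  haveI hℓ : Fact (primesEquiv v : ℕ).Prime := ⟨(primesEquiv v).2⟩
  have hℓp : (primesEquiv v : ℕ) ≠ p := by
    intro h
    apply hpv
    rw [← h]
    exact (natCast_mem_asIdeal_iff_eq_primesEquiv_symm v hℓ.out).mpr (by simp)
  have hmult' : (haveI := Fact.mk (primesEquiv v).2;
      W.HasMultiplicativeReductionAtPrime (primesEquiv v)) :=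
    (hasMultiplicativeReductionAtPrime_iff_hasMultiplicativeReductionAt_ringOfIntegers W v).mpr hmult
  have hram : ¬ p ∣ padicValNat (primesEquiv v) W.minimalDiscriminantInt.natAbs := by
    have h := LocalTorsionMult.ordMinimalDiscriminant_eq_padicValInt W v (q := (primesEquiv v : ℕ)) rfl
    rwa [h] at hnd
  obtain ⟨σ, hσ, Q, hpQ, hσQ⟩ :=
    W.exists_inertia_smul_ne_of_hasMultiplicativeReductionAtPrime v hp.out hℓp hmult' hram hw h𝔐
  rw [v.inertia_eq_absInertia hw h𝔐] at hσ
  -- the moved `p`-torsion point comes from `E(ℚ̄)`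
  obtain ⟨P₀, hpP₀, hP₀Q⟩ := exists_pointsMapOfEmb_eq_of_nsmul_eq_zero W
    (closureEmb (K := ℚ) (v.adicCompletion ℚ)) hp.out.ne_zero hpQ
  have hmem : P₀ ∈ geomTorsion W (p : ℤ) :=
    (Submodule.mem_torsionBy_iff _ _).mpr (show (p : ℤ) • P₀ = 0 by rw [natCast_zsmul, hpP₀])
  refine ⟨σ, hσ, ⟨P₀, hmem⟩, fun h ↦ hσQ ?_⟩
  have h' := congrArg
    (fun R : geomTorsion W (p : ℤ) ↦ pointsMap W (v.adicCompletion ℚ) (R : geomPoints W)) h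
  simp only [AddSubgroup.torsionBy.coe_smul, pointsMap_smul] at h'
  rw [← hP₀Q]
  exact h'

/-- **Multiplicative reduction at `v ∤ p` ⟹ `E[p]` has a non-zero `I_v`-fixed vector** (the point
`P₁ = ζ_p` of the Tate basis; tree `exists_tateBasis_localPoints_of_hasMultiplicativeReductionAt`,
read on `E(ℚ̄)[p]`). [cite: SilvermanATAEC1994, V.4–V.5 (Tate curve), Exercise 5.13(b)]
[cite: SerreInventiones1972, §1.12] -/
theorem exists_fixed_ne_zero_of_mult [W.IsElliptic]
    (hpv : (p : 𝓞 ℚ) ∉ v.asIdeal) (hmult : W.HasMultiplicativeReductionAt v) :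
    ∃ P : geomTorsion W (p : ℤ), P ≠ 0 ∧ ∀ τ ∈ absInertia (v.adicCompletion ℚ),
      resGal (K := ℚ) (v.adicCompletion ℚ) τ • P = P := by
  obtain ⟨w, hw⟩ := v.exists_spectralValuation
  obtain ⟨𝔐, h𝔐⟩ := v.localPrimesAbove_nonempty
  obtain ⟨P₁, P₂, hpP₁, -, hP₁, -, hfix⟩ :=
    W.exists_tateBasis_localPoints_of_hasMultiplicativeReductionAt hmult hp.out hpv (n := 1) le_rfl
      hw h𝔐
  rw [pow_one] at hpP₁
  rw [Nat.sub_self, pow_zero, one_smul] at hP₁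
  -- `P₁` comes from `E(ℚ̄)`
  obtain ⟨P₀, hpP₀, hP₀Q⟩ := exists_pointsMapOfEmb_eq_of_nsmul_eq_zero W
    (closureEmb (K := ℚ) (v.adicCompletion ℚ)) hp.out.ne_zero hpP₁
  have hmem : P₀ ∈ geomTorsion W (p : ℤ) :=
    (Submodule.mem_torsionBy_iff _ _).mpr (show (p : ℤ) • P₀ = 0 by rw [natCast_zsmul, hpP₀])
  refine ⟨⟨P₀, hmem⟩, fun h0 ↦ hP₁ ?_, fun τ hτ ↦ ?_⟩
  · have h0' : P₀ = 0 := congrArg Subtype.val h0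
    rw [← hP₀Q, h0']
    exact map_zero _
  · rw [← v.inertia_eq_absInertia hw h𝔐] at hτ
    apply Subtype.ext
    rw [AddSubgroup.torsionBy.coe_smul]
    apply pointsMapOfEmb_injective W (closureEmb (K := ℚ) (v.adicCompletion ℚ))
    change pointsMap W (v.adicCompletion ℚ) _ = pointsMap W (v.adicCompletion ℚ) _
    rw [pointsMap_smul]
    change τ • pointsMapOfEmb W (closureEmb (K := ℚ) (v.adicCompletion ℚ)) P₀ =
      pointsMapOfEmb W (closureEmb (K := ℚ) (v.adicCompletion ℚ)) P₀
    rw [hP₀Q]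
    exact (hfix τ hτ).1

/-- **Additive reduction at `v ∤ p`, `p ≥ 5` ⟹ `E[p]^{I_v} = 0`** (Kodaira–Néron `c_v ≤ 4`; tree
`Iwasawa.localPoints_eq_zero_of_absInertia_fixed_of_hasAdditiveReductionAt`, read on `E(ℚ̄)[p]`).
Greenberg, LNM 1716, p. 88 / Prop. 3.8 ("`E[p^∞]^{I_l} = 0` if `p ≥ 5`").
[cite: GreenbergLNM1716, §3 p. 88 and Prop. 3.8 (proof, p. 96)] [cite: SilvermanAEC2009, Thm. VII.6.1] -/
theorem eq_zero_of_fixed_of_additive [W.IsElliptic] (hp5 : 5 ≤ p)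
    (hpv : (p : 𝓞 ℚ) ∉ v.asIdeal) (hadd : W.HasAdditiveReductionAt v)
    (P : geomTorsion W (p : ℤ))
    (hP : ∀ τ ∈ absInertia (v.adicCompletion ℚ), resGal (K := ℚ) (v.adicCompletion ℚ) τ • P = P) :
    P = 0 := by
  set R : localPoints W (v.adicCompletion ℚ) := pointsMap W (v.adicCompletion ℚ) (P : geomPoints W)
    with hR
  have hRfix : ∀ τ ∈ absInertia (v.adicCompletion ℚ), τ • R = R := fun τ hτ ↦ by
    rw [hR, ← pointsMap_smul, ← AddSubgroup.torsionBy.coe_smul, hP τ hτ]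
  have hpP : (p : ℤ) • (P : geomPoints W) = 0 := (Submodule.mem_torsionBy_iff (p : ℤ) P.1).mp P.2
  have hpR : p ^ 1 • R = 0 := by
    rw [pow_one, hR, ← natCast_zsmul, ← map_zsmul, hpP, map_zero]
  have hR0 : R = 0 :=
    Iwasawa.localPoints_eq_zero_of_absInertia_fixed_of_hasAdditiveReductionAt W v hpv hp5 hadd R
      hRfix 1 hpR
  apply Subtype.ext
  apply pointsMapOfEmb_injective W (closureEmb (K := ℚ) (v.adicCompletion ℚ))
  change pointsMap W (v.adicCompletion ℚ) _ = pointsMap W (v.adicCompletion ℚ) _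
  rw [← hR, hR0, ZeroMemClass.coe_zero, map_zero]

omit hp in
/-- **Good reduction at `v ∤ p` ⟹ `E[p]` is unramified at `v`** (Silverman *AEC* VII.4.1; tree
`smul_localPoints_eq_of_mem_inertia_holds`, read on `E(ℚ̄)[p]`). [cite: SilvermanAEC2009, Prop. VII.4.1(a)] -/
theorem smul_eq_of_good [W.IsElliptic] (hpv : (p : 𝓞 ℚ) ∉ v.asIdeal) (hgood : W.HasGoodReductionAt v)
    {τ : absoluteGaloisGroup (v.adicCompletion ℚ)} (hτ : τ ∈ absInertia (v.adicCompletion ℚ))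
    (P : geomTorsion W (p : ℤ)) : resGal (K := ℚ) (v.adicCompletion ℚ) τ • P = P := by
  obtain ⟨w, hw⟩ := v.exists_spectralValuation
  obtain ⟨𝔐, h𝔐⟩ := v.localPrimesAbove_nonempty
  rw [← v.inertia_eq_absInertia hw h𝔐] at hτ
  have hv' : v ∉ W.badPlaces (𝓞 ℚ) := fun h ↦ h hgood
  set R : localPoints W (v.adicCompletion ℚ) := pointsMap W (v.adicCompletion ℚ) (P : geomPoints W)
    with hR
  have hpR : (p : ℤ) • R = 0 := by
    rw [hR, ← map_zsmul, (Submodule.mem_torsionBy_iff (p : ℤ) P.1).mp P.2, map_zero]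
  have hfix : τ • R = R :=
    W.smul_localPoints_eq_of_mem_inertia_holds v hv' (n := (p : ℤ)) (by exact_mod_cast hpv) h𝔐 hτ
      (by rw [smul_sub, smul_comm, hpR, smul_zero, sub_self])
  apply Subtype.ext
  rw [AddSubgroup.torsionBy.coe_smul]
  apply pointsMapOfEmb_injective W (closureEmb (K := ℚ) (v.adicCompletion ℚ))
  change pointsMap W (v.adicCompletion ℚ) _ = pointsMap W (v.adicCompletion ℚ) _
  rw [pointsMap_smul, ← hR, hfix]

/-- **Multiplicative reduction at `v ∤ p` with `p ∣ ord_v(Δ_min)` ⟹ `E[p]` is unramified at `v`**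
(Serre 1972 n° 1.12; tree `smul_eq_of_mem_inertia_of_hasMultiplicativeReductionAt_of_dvd`, read on
`E(ℚ̄)[p]`). [cite: SerreInventiones1972, n° 1.12] [cite: Serre1987, §4.1 (4.1.12)] -/
theorem smul_eq_of_mult_of_dvd [W.IsElliptic] (hpv : (p : 𝓞 ℚ) ∉ v.asIdeal)
    (hmult : W.HasMultiplicativeReductionAt v) (hdvd : p ∣ W.ordMinimalDiscriminant v)
    {τ : absoluteGaloisGroup (v.adicCompletion ℚ)} (hτ : τ ∈ absInertia (v.adicCompletion ℚ))
    (P : geomTorsion W (p : ℤ)) : resGal (K := ℚ) (v.adicCompletion ℚ) τ • P = P := by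
  obtain ⟨w, hw⟩ := v.exists_spectralValuation
  obtain ⟨𝔐, h𝔐⟩ := v.localPrimesAbove_nonempty
  rw [← v.inertia_eq_absInertia hw h𝔐] at hτ
  set R : localPoints W (v.adicCompletion ℚ) := pointsMap W (v.adicCompletion ℚ) (P : geomPoints W)
    with hR
  have hpP : (p : ℤ) • (P : geomPoints W) = 0 := (Submodule.mem_torsionBy_iff (p : ℤ) P.1).mp P.2
  have hpR : p • R = 0 := by
    rw [hR, ← natCast_zsmul, ← map_zsmul, hpP, map_zero]
  have hfix : τ • R = R :=
    W.smul_eq_of_mem_inertia_of_hasMultiplicativeReductionAt_of_dvd hmult hp.out hpv hdvd hw h𝔐 hτ R hpR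
  apply Subtype.ext
  rw [AddSubgroup.torsionBy.coe_smul]
  apply pointsMapOfEmb_injective W (closureEmb (K := ℚ) (v.adicCompletion ℚ))
  change pointsMap W (v.adicCompletion ℚ) _ = pointsMap W (v.adicCompletion ℚ) _
  rw [pointsMap_smul, ← hR, hfix]

end Local

/-! ## §3 `Ram` is an invariant of the `Γ_ℚ`-module `E[p]` for `p ≥ 5` -/

section Main

/-- **Place form of (ram).** For a globally minimal `W/ℚ`: `Ram W p` (some prime `ℓ ≠ p` of
multiplicative reduction with `p ∤ v_ℓ(Δ_min)`) iff some finite place `v ∤ p` of `𝓞 ℚ` is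
multiplicative for `W` with `p ∤ ord_v(Δ_min)` (`LocalTorsionMult.ordMinimalDiscriminant_eq_padicValInt`,
`hasMultiplicativeReductionAtPrime_iff_hasMultiplicativeReductionAt_ringOfIntegers`). [folklore] -/
theorem ram_iff_exists_place [W.IsElliptic] [W.IsGloballyMinimal] :
    Ram W p ↔ ∃ v : HeightOneSpectrum (𝓞 ℚ), (p : 𝓞 ℚ) ∉ v.asIdeal ∧
      W.HasMultiplicativeReductionAt v ∧ ¬ p ∣ W.ordMinimalDiscriminant v := by
  constructor
  · rintro ⟨ℓ, hℓ, hℓp, hmult, hnd⟩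
    set v : HeightOneSpectrum (𝓞 ℚ) := (primesEquiv (R := 𝓞 ℚ)).symm ⟨ℓ, hℓ.out⟩ with hvdef
    have hv : primesEquiv v = ⟨ℓ, hℓ.out⟩ := Equiv.apply_symm_apply _ _
    refine ⟨v, natCast_not_mem_of_ne v hℓ.out hv hℓp, ?_, ?_⟩
    · have key : ∀ q : Nat.Primes, primesEquiv v = q →
          (haveI := Fact.mk q.2; W.HasMultiplicativeReductionAtPrime (q : ℕ)) →
            W.HasMultiplicativeReductionAt v := by
        rintro q rfl h
        exact (hasMultiplicativeReductionAtPrime_iff_hasMultiplicativeReductionAt_ringOfIntegers W v).mp h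
      exact key ⟨ℓ, hℓ.out⟩ hv hmult
    · rw [LocalTorsionMult.ordMinimalDiscriminant_eq_padicValInt W v (q := ℓ) (congrArg Subtype.val hv)]
      exact hnd
  · rintro ⟨v, hpv, hmult, hnd⟩
    haveI hℓ : Fact (primesEquiv v : ℕ).Prime := ⟨(primesEquiv v).2⟩
    refine ⟨(primesEquiv v : ℕ), hℓ, ?_, ?_, ?_⟩
    · intro h
      apply hpv
      rw [← h]
      exact (natCast_mem_asIdeal_iff_eq_primesEquiv_symm v hℓ.out).mpr (by simp)
    · exact (hasMultiplicativeReductionAtPrime_iff_hasMultiplicativeReductionAt_ringOfIntegers W v).mpr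
        hmult
    · rw [← LocalTorsionMult.ordMinimalDiscriminant_eq_padicValInt W v (q := (primesEquiv v : ℕ)) rfl]
      exact hnd

/-- **(ram) is transported along a mod-`p` congruence, `p ≥ 5`.** Let `W, W'/ℚ` be elliptic curves
given by globally minimal equations, `p ≥ 5` a prime and `e : W[p] ≃ W'[p]` a `Γ_ℚ`-equivariant
isomorphism. If `W` has a prime `ℓ ≠ p` of multiplicative reduction with `p ∤ v_ℓ(Δ_min(W))`
(`Ram W p`: Skinner 2016 Thm. C (ii) / Skinner–Urban 2014 Thm. 3.6.4 (iii) in Tate-curve form), then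
so has `W'`, at the SAME `ℓ`. Proof: at the place `v` of `ℓ`, `W[p]` is ramified with a non-zero
inertia-fixed vector (§2, Tate curve); both pass to `W'[p]` along `e` (§1); so `W'` is not good at
`v` (good ⇒ unramified), not additive (`p ≥ 5`: no fixed vector), hence multiplicative, and
`p ∤ ord_v(Δ_min(W'))` (else unramified, Serre 1972 n° 1.12).
[cite: SerreInventiones1972, §1.11–1.12] [cite: SilvermanAEC2009, Prop. VII.4.1(a), Thm. VII.6.1]
[cite: GreenbergLNM1716, §3 p. 88] -/
theorem ram_of_torsionIso [W.IsElliptic] [W.IsGloballyMinimal] [W'.IsElliptic] [W'.IsGloballyMinimal]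
    (hp5 : 5 ≤ p) (e : geomTorsion W (p : ℤ) ≃+ geomTorsion W' (p : ℤ))
    (he : ∀ (σ : absoluteGaloisGroup ℚ) (P : geomTorsion W (p : ℤ)), e (σ • P) = σ • e P)
    (h : Ram W p) : Ram W' p := by
  rw [ram_iff_exists_place] at h ⊢
  obtain ⟨v, hpv, hmult, hnd⟩ := h
  -- `W[p]` is ramified at `v` with a non-zero inertia-fixed vector; transport both along `e`
  have hram := exists_smul_ne_of_torsionIso v e he
    (exists_smul_ne_of_mult_of_not_dvd W v hpv hmult hnd)
  have hfix := exists_fixed_ne_zero_of_torsionIso v e he (exists_fixed_ne_zero_of_mult W v hpv hmult)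
  -- hence `W'` is multiplicative at `v`
  have hm : W'.HasMultiplicativeReductionAt v := by
    rcases W'.hasGoodReductionAt_or_hasMultiplicativeReductionAt_or_hasAdditiveReductionAt v with
      hg | hm | ha
    · exfalso
      obtain ⟨τ, hτ, P, hP⟩ := hram
      exact hP (smul_eq_of_good W' v hpv hg hτ P)
    · exact hm
    · exfalso
      obtain ⟨P, hP0, hP⟩ := hfix
      exact hP0 (eq_zero_of_fixed_of_additive W' v hp5 hpv ha P hP)
  -- and `p ∤ ord_v(Δ_min(W'))`
  refine ⟨v, hpv, hm, fun hdvd ↦ ?_⟩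
  obtain ⟨τ, hτ, P, hP⟩ := hram
  exact hP (smul_eq_of_mult_of_dvd W' v hpv hm hdvd hτ P)

/-- **(ram) is an invariant of the mod-`p` Galois module for `p ≥ 5`**: for `Γ_ℚ`-isomorphic
`W[p] ≃ W'[p]` (globally minimal elliptic `W, W'/ℚ`), `Ram W p ↔ Ram W' p`. In particular Skinner's
hypothesis (ii) cannot be acquired by passing to ANY `p`-congruent elliptic curve (level-raised,
level-lowered, Hida-branch member, CM partner) if the curve itself lacks it. The bound `5 ≤ p` is
sharp (`p = 3`: additive primes of Kodaira type IV / IV*). [cite: SerreInventiones1972, §1.11–1.12]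
[cite: Skinner2016PacificMC, Thm. C hypothesis (ii) and §2.5] -/
theorem ram_iff_of_torsionIso [W.IsElliptic] [W.IsGloballyMinimal] [W'.IsElliptic]
    [W'.IsGloballyMinimal] (hp5 : 5 ≤ p) (e : geomTorsion W (p : ℤ) ≃+ geomTorsion W' (p : ℤ))
    (he : ∀ (σ : absoluteGaloisGroup ℚ) (P : geomTorsion W (p : ℤ)), e (σ • P) = σ • e P) :
    Ram W p ↔ Ram W' p :=
  ⟨ram_of_torsionIso hp5 e he, ram_of_torsionIso hp5 e.symm (torsionIso_symm_smul e he)⟩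

/-- **No congruent partner of a (ram)-free pair has (ram)** (`p ≥ 5`). `Ram G p` is VERBATIM the
seed clause "`∃ ℓ ≠ p`, `G` multiplicative at `ℓ`, `p ∤ v_ℓ(Δ_G)`" of the Skinner–Urban-seeded Fouquet
transport `Fouquet2025.padicValRat_bsd_rank_zero_of_ordinaryCongruence_anyReduction` (fact (A)): on a
(ram)-free target that road has NO seed among `p`-congruent curves (its `a_ℓ`-congruence hypothesis
gives `G[p] ≃ W[p]` by Brauer–Nesbitt / Kraus–Oesterlé Prop. 4, `W[p]` irreducible); only the
BCS-seeded variant (`…_of_congruence_of_bcsSeed`, good-ordinary seed, no (ram)) survives.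
[cite: Fouquet2025EquivariantTNC, Thm 4.1 (1)⇒(2) with the Skinner–Urban seed (pp. 24–25)] -/
theorem not_ram_of_torsionIso [W.IsElliptic] [W.IsGloballyMinimal] [W'.IsElliptic]
    [W'.IsGloballyMinimal] (hp5 : 5 ≤ p) (e : geomTorsion W (p : ℤ) ≃+ geomTorsion W' (p : ℤ))
    (he : ∀ (σ : absoluteGaloisGroup ℚ) (P : geomTorsion W (p : ℤ)), e (σ • P) = σ • e P)
    (hX : ¬ Ram W p) : ¬ Ram W' p :=
  fun h ↦ hX ((ram_iff_of_torsionIso hp5 e he).mpr h)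

/-! ### The X11a reading: seat p2's «manufacture the auxiliary prime» has no target at `p ≥ 5` -/
/-- **No `p`-congruent partner of an X11a pair lies in Skinner's row C1 at `p`** (`p ≥ 5`): for
`(W, p) ∈ ClassX11a` and any globally minimal elliptic `W'/ℚ` with `W'[p] ≃ W[p]` as `Γ_ℚ`-modules,
`¬ RowC1 W' p` — Skinner 2016 Thm. C is silent on every congruent curve (level-raising à la Ribet /
Diamond–Taylor changes the newform, not `ρ̄`; its new prime has `ρ̄` unramified).
[cite: Skinner2016PacificMC, Thm. C (ii)] -/
theorem not_rowC1_of_torsionIso_of_classX11a [W.IsElliptic] [W.IsGloballyMinimal] [W'.IsElliptic]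
    [W'.IsGloballyMinimal] (hp5 : 5 ≤ p) (hX : ClassX11a W p)
    (e : geomTorsion W (p : ℤ) ≃+ geomTorsion W' (p : ℤ))
    (he : ∀ (σ : absoluteGaloisGroup ℚ) (P : geomTorsion W (p : ℤ)), e (σ • P) = σ • e P) :
    ¬ RowC1 W' p :=
  fun h ↦ not_ram_of_torsionIso hp5 e he hX.2.2.2.2 h.2.2.2.2

/-- **Nor on the Skinner–Zhang locus nor on Castella's erratum-A′ locus** (`p ≥ 5`): both need a
ramified multiplicative `q ≠ p` (`ram_of_skinnerZhang_hypotheses`, `ram_of_erratumAprime_hypothesis`),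
which no congruent partner of an X11a pair has. [cite: SkinnerZhang2014, Thm. 1.1 (e) (arXiv:1407.1099v1 p. 1)] -/
theorem not_skinnerZhang_of_torsionIso_of_classX11a [W.IsElliptic] [W.IsGloballyMinimal]
    [W'.IsElliptic] [W'.IsGloballyMinimal] (hp5 : 5 ≤ p) (hX : ClassX11a W p)
    (e : geomTorsion W (p : ℤ) ≃+ geomTorsion W' (p : ℤ))
    (he : ∀ (σ : absoluteGaloisGroup ℚ) (P : geomTorsion W (p : ℤ)), e (σ • P) = σ • e P) :
    ¬ SkinnerZhang2014.Hypotheses W' p ∧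
    ¬ (∃ (q : ℕ) (_ : Fact q.Prime), q ≠ p ∧ W'.HasMultiplicativeReductionAtPrime q ∧
        ¬ W'.HasSplitMultiplicativeReductionAtPrime q ∧ ¬ p ∣ padicValInt q W'.minimalDiscriminantInt) :=
  not_skinnerZhang_and_not_erratumAprime_of_not_ram (not_ram_of_torsionIso hp5 e he hX.2.2.2.2)

end Main

end Summit.BirchSwinnertonDyer.BirchSwinnertonDyer.Theorems.RamCongruence

end
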